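import Literature.IUT.HodgeTheaters.GlobalFrobenioidsRealifyRlfPrimes
import HarnessLib

/-!
# [IUTchI] Example 3.5 (i) ↔ [FrdI] Def 2.4 (i): THE isomorphism `Φ(L)^rlf ≃ Φ_{𝒞⊩_mod}` under `Φ(L)` (PROOF-ONLY)

Mochizuki, *Inter-universal Teichmüller theory I*, §3, Example 3.5 (i), kurims manuscript (May 2020) p. 84
([IUTchI] Ex 3.5 (i) p.84) [claim: Mochizuki2012, status: disputed]: `𝒞⊩_mod` is "the realification [cf. [FrdI],
Theorem 6.4, (ii)] of the Frobenioid of [FrdI], Example 6.3 [cf. also Remark 3.1.5 of the present paper], associated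
to the number field `F_mod`" and "the submonoid `Φ_{𝒞⊩_mod,v}` of `Φ_{𝒞⊩_mod}` corresponding to `v ∈ V_mod` is
naturally isomorphic to `ord(𝒪^▷_{(F_mod)_v})^pf ⊗ ℝ_{≥0}`" (both p. 84); Rmk 3.1.5 pp. 65–66 (arithmetic line bundles
over the stack `S_mod`; "upon passing to either the perfection or the realification, such stack-theoretic versions
become naturally isomorphic to the non-stack-theoretic versions"); Ex 5.1 (iii) p. 126 ("the Frobenioid `†ℱ^⊛_mod`
may be thought of as the Frobenioid of arithmetic line bundles on the stack `S_mod` of Remark 3.1.5").  OUR PARAPHRASE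
of p. 84 + Rmk 3.1.5 + p. 126 read jointly (not a quotation): `𝒞⊩_mod` is the realification of the Frobenioid of
arithmetic line bundles `†ℱ^⊛_mod`.  Mochizuki, *The geometry of Frobenioids I*, Kyushu J. Math. **62** (2008),
Def 2.4 (i) p. 48 (the realification `M^rlf ⊆ ∏_𝔮 M^rlf_𝔮`) and Ex 6.3 p. 113.

Doc-only v2 (abc-iut-w4-d073 gen 5; referee finding M18-F2, HOME/ref/REFEREE-PASS-M18.md §14): two composite glosses
that v1 printed inside quotation marks are now given as paraphrase with the three loci cited jointly; all
declarations are byte-identical to v1 (p427854).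

PROOF-ONLY (no `def`, no instance; abc-iut-w4-d073 gen 4; the after-merge item recorded in
`GlobalFrobenioidsRealifyUniversal.lean` / `GlobalFrobenioidsRealifyProofs.lean`: "NOT done here: an explicit monoid
isomorphism `Φ(L)^rlf ≃* Φ_{𝒞⊩_mod}` under `Φ(L)`").  Notation as in `GlobalFrobenioidsRealifyRlfPrimes.lean`:
`Φ(L) = EffArithDivisor L`, `Φ(L)^rlf = (EffArithDivisor.isPerfFactorial L).Rlf` (abc-iut-L1's INTRINSIC realification),
`ι : Φ(L) → Φ(L)^pf → Φ(L)^rlf`, `Φ_{𝒞⊩_mod} = (V(L) →₀ ℝ_{≥0})` with `realifyMod : Φ(L) → Φ_{𝒞⊩_mod}` (abc-iut-L5-t2 /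
abc-iut-w4-d050, `log⊢_mod(p_v) ↦ 1` coordinates).

* `EffArithDivisor.exists_rlfEquiv_realifyMod` — **there is a monoid isomorphism `Ψ : Φ(L)^rlf ≃* Φ_{𝒞⊩_mod}`
  (multiplicative rendering of the target) with `Ψ ∘ ι = realifyMod`**: abc-iut-L5-t2's `PhiMod` IS abc-iut-L1's
  realification of the divisor monoid of `†ℱ^⊛_mod`, as [IUTchI] Ex 3.5 (i) / Ex 5.1 (iii) say
  (`exists_rlfHom_realifyMod_bijective` is the same with the bijection spelled out, `exists_rlfEquiv_symm_realifyMod` the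
  inverse direction);
* `EffArithDivisor.rlf_hom_nnreal_ext` / `rlf_hom_phiMod_ext` — a homomorphism `Φ(L)^rlf → ℝ_{≥0}` (resp.
  `→ Φ_{𝒞⊩_mod}`) is determined by its restriction along `ι` (the uniqueness half of the universal property of the
  realification, WITHOUT the hypothesis "`ℝ` supports `ℝ_{≥0}`"); hence `Ψ` is UNIQUE
  (`EffArithDivisor.existsUnique_rlfHom_realifyMod`): the identification is canonical.

Method ("prime by prime"): `Prime(Φ(L)^pf) ≃ V(L)`; `Ψ` reads off the `ℝ_{≥0}`-coordinate of the `𝔮_v`-component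
(`Φ(L)^rlf_{𝔮_v} ≅ ℝ_{≥0}` is `ℝ`-monoprime), normalised so that `ι(δ_v) ↦ realifyMod(δ_v)`; additive self-maps of
`ℝ_{≥0}` are homotheties.  No new Prop fact; no statement of the paper is strengthened; no side is taken on
[IUTchIII] Cor. 3.12.
-/

noncomputable section

open scoped Classical NNReal

namespace Literature.IUT.HodgeTheaters

open Function NumberField Literature.AlgebraicGeometry.Frobenioids Literature.AnabelianGeometry.EtaleTheta

variable (L : Type) [Field L] [NumberField L]

/-! ### Homomorphisms `Φ(L)^rlf → ℝ_{≥0}` are determined along `ι` -/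

/-- **A homomorphism `Φ(L)^rlf → ℝ_{≥0}` is determined by its restriction to `Φ(L)`** (along
`ι : Φ(L) → Φ(L)^pf → Φ(L)^rlf`): on each one-prime factor `Φ(L)^rlf_𝔮 ≅ ℝ_{≥0}` it is a homothety fixed by its
value at `ι(δ_v)`, and every element of `Φ(L)^rlf` is a finite product of one-prime elements — the uniqueness half of
the universal property of the realification, here WITHOUT the hypothesis "`ℝ` supports `ℝ_{≥0}`".
([IUTchI] Ex 3.5 (i) p.84) [claim: Mochizuki2012, status: disputed] -/
theorem EffArithDivisor.rlf_hom_nnreal_ext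
    {χ₁ χ₂ : (EffArithDivisor.isPerfFactorial L).Rlf →* Multiplicative ℝ≥0}
    (h : ∀ a : EffArithDivisor L,
      χ₁ ((EffArithDivisor.isPerfFactorial L).toRealification (Perfection.of _ (Multiplicative.ofAdd a))) =
        χ₂ ((EffArithDivisor.isPerfFactorial L).toRealification (Perfection.of _ (Multiplicative.ofAdd a)))) :
    χ₁ = χ₂ := by
  have hP := EffArithDivisor.isPerfFactorial L
  -- Step 1: agreement on the one-prime elements `single 𝔮 y`
  have hsingle : ∀ (𝔮 : Literature.AlgebraicGeometry.Frobenioids.Primes (Perfection (Multiplicative (EffArithDivisor L))))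
      (y : RlfAt (Multiplicative (EffArithDivisor L)) 𝔮), χ₁ (hP.single 𝔮 y) = χ₂ (hP.single 𝔮 y) := by
    intro 𝔮 y
    obtain ⟨v, rfl⟩ := (EffArithDivisor.pfPrimeOf_bijective L).2 𝔮
    obtain ⟨⟨j⟩⟩ := hP.isRMonoprime_rlfAt (Quotient.mk (primarySetoid _) ⟨_, EffArithDivisor.isPrimary_of_single L v⟩)
    -- `single 𝔮 _` as a monoid homomorphism
    let s : RlfAt (Multiplicative (EffArithDivisor L))
        (Quotient.mk (primarySetoid _) ⟨_, EffArithDivisor.isPrimary_of_single L v⟩) →* hP.Rlf :=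
      { toFun := hP.single (Quotient.mk (primarySetoid _) ⟨_, EffArithDivisor.isPrimary_of_single L v⟩)
        map_one' := Subtype.ext (IsPerfFactorial.single'_one _)
        map_mul' := fun a b => Subtype.ext (IsPerfFactorial.single'_mul _ a b) }
    have hs : ∀ z, s z = hP.single _ z := fun _ => rfl
    -- the additive maps `ℝ≥0 → ℝ≥0`, `t ↦ χᵢ (single 𝔮 (j⁻¹ t))`
    let f : ((EffArithDivisor.isPerfFactorial L).Rlf →* Multiplicative ℝ≥0) → (ℝ≥0 →+ ℝ≥0) := fun χ =>
      { toFun := fun t => Multiplicative.toAdd (χ (s (j.symm (Multiplicative.ofAdd t))))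
        map_zero' := by rw [ofAdd_zero, map_one, map_one, map_one, toAdd_one]
        map_add' := fun t t' => by rw [ofAdd_add, map_mul, map_mul, map_mul, toAdd_mul] }
    have hf : ∀ χ t, f χ t = Multiplicative.toAdd (χ (s (j.symm (Multiplicative.ofAdd t)))) := fun _ _ => rfl
    -- the reference point: the `𝔮_v`-component `y₀` of `ι(δ_v)`, where `χ₁`, `χ₂` agree and which is nonzero
    set y₀ := (((EffArithDivisor.isPerfFactorial L).toRealification
        (Perfection.of _ (Multiplicative.ofAdd (EffArithDivisor.single L v))) :
        (EffArithDivisor.isPerfFactorial L).Rlf) : RlfFactor (Multiplicative (EffArithDivisor L)))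
      (Quotient.mk (primarySetoid _) ⟨_, EffArithDivisor.isPrimary_of_single L v⟩) with hy₀
    have hy₀ne : Multiplicative.toAdd (j y₀) ≠ 0 := by
      intro h0
      exact EffArithDivisor.iota_single_apply_ne_one L v ((j.map_eq_one_iff).mp (toAdd_eq_zero.mp h0))
    have hagree : f χ₁ (Multiplicative.toAdd (j y₀)) = f χ₂ (Multiplicative.toAdd (j y₀)) := by
      rw [hf, hf, ofAdd_toAdd, MulEquiv.symm_apply_apply, hs, ← EffArithDivisor.iota_single_eq_rlfSingle L v]
      exact congrArg Multiplicative.toAdd (h (EffArithDivisor.single L v))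
    have hone : f χ₁ 1 = f χ₂ 1 := by
      have h1 := addMonoidHom_nnreal_apply (f χ₁) (Multiplicative.toAdd (j y₀))
      have h2 := addMonoidHom_nnreal_apply (f χ₂) (Multiplicative.toAdd (j y₀))
      rw [hagree, h2] at h1
      exact (mul_right_cancel₀ hy₀ne h1).symm
    have hall : f χ₁ (Multiplicative.toAdd (j y)) = f χ₂ (Multiplicative.toAdd (j y)) := by
      rw [addMonoidHom_nnreal_apply (f χ₁), addMonoidHom_nnreal_apply (f χ₂), hone]
    rw [hf, hf, ofAdd_toAdd, MulEquiv.symm_apply_apply, hs] at hall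
    exact Multiplicative.toAdd.injective hall
  -- Step 2: induction on a finite set containing the support
  have key : ∀ (S : Finset (Literature.AlgebraicGeometry.Frobenioids.Primes (Perfection (Multiplicative (EffArithDivisor L)))))
      (x : hP.Rlf), supp (x : RlfFactor (Multiplicative (EffArithDivisor L))) ⊆ ↑S → χ₁ x = χ₂ x := by
    intro S
    refine Finset.induction_on S (fun x hx => ?_) (fun 𝔮 S h𝔮S ih x hx => ?_)
    · have hx1 : x = 1 := by
        by_contra hne
        obtain ⟨𝔮, h𝔮⟩ := (IsPerfFactorial.Rlf.ne_one_iff_supp_nonempty hP x).mp hne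
        simpa using hx h𝔮
      rw [hx1, map_one, map_one]
    · obtain ⟨x', hxx', hx'𝔮, hsub⟩ := IsPerfFactorial.Rlf.exists_eq_restrict_mul hP x 𝔮
      have hx'S : supp (x' : RlfFactor (Multiplicative (EffArithDivisor L))) ⊆ ↑S := by
        intro 𝔮' h𝔮'
        have hne : 𝔮' ≠ 𝔮 := by
          rintro rfl
          exact h𝔮' hx'𝔮
        have hmem := hx (hsub h𝔮')
        rw [Finset.coe_insert, Set.mem_insert_iff] at hmem
        exact hmem.resolve_left hne
      rw [hxx', map_mul, map_mul, ih x' hx'S]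
      congr 1
      exact hsingle 𝔮 _
  refine MonoidHom.ext fun x => key (EffArithDivisor.supp_coe_rlf_finite L x).toFinset x fun 𝔮 h𝔮 => ?_
  rw [Finset.mem_coe, Set.Finite.mem_toFinset]
  exact h𝔮

/-- **A homomorphism `Φ(L)^rlf → Φ_{𝒞⊩_mod}` is determined by its restriction to `Φ(L)`** (coordinate by
coordinate, `EffArithDivisor.rlf_hom_nnreal_ext`). ([IUTchI] Ex 3.5 (i) p.84) [claim: Mochizuki2012, status: disputed] -/
theorem EffArithDivisor.rlf_hom_phiMod_ext
    {Ψ₁ Ψ₂ : (EffArithDivisor.isPerfFactorial L).Rlf →* Multiplicative (Val L →₀ ℝ≥0)}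
    (h : ∀ a : EffArithDivisor L,
      Ψ₁ ((EffArithDivisor.isPerfFactorial L).toRealification (Perfection.of _ (Multiplicative.ofAdd a))) =
        Ψ₂ ((EffArithDivisor.isPerfFactorial L).toRealification (Perfection.of _ (Multiplicative.ofAdd a)))) :
    Ψ₁ = Ψ₂ := by
  refine MonoidHom.ext fun x => ?_
  apply Multiplicative.toAdd.injective
  refine Finsupp.ext fun v => ?_
  have key := EffArithDivisor.rlf_hom_nnreal_ext L
    (χ₁ := (AddMonoidHom.toMultiplicative (Finsupp.applyAddHom v)).comp Ψ₁)
    (χ₂ := (AddMonoidHom.toMultiplicative (Finsupp.applyAddHom v)).comp Ψ₂) fun a => by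
      rw [MonoidHom.comp_apply, MonoidHom.comp_apply, h a]
  have hx := DFunLike.congr_fun key x
  simp only [MonoidHom.comp_apply, AddMonoidHom.toMultiplicative_apply_apply, Finsupp.applyAddHom_apply] at hx
  exact Multiplicative.ofAdd.injective hx

/-! ### The isomorphism `Φ(L)^rlf ≃ Φ_{𝒞⊩_mod}` under `Φ(L)` -/

/-- **[IUTchI] Ex 3.5 (i) ↔ [FrdI] Def 2.4 (i): `Φ_{𝒞⊩_mod}` IS the realification of `Φ(L)` — a BIJECTIVE
homomorphism `Ψ : Φ(L)^rlf → Φ_{𝒞⊩_mod}` with `Ψ ∘ ι = realifyMod`.**  `Ψ` reads off, prime by prime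
(`Prime(Φ(L)^pf) ≃ V(L)`), the `ℝ_{≥0}`-coordinate of the `𝔮_v`-component (`Φ(L)^rlf_{𝔮_v} ≅ ℝ_{≥0}`), normalised so
that `ι(δ_v) ↦ realifyMod(δ_v)` (`log⊢_mod(p_v) ↦ 1`). ([IUTchI] Ex 3.5 (i) p.84) [claim: Mochizuki2012, status: disputed] -/
theorem EffArithDivisor.exists_rlfHom_realifyMod_bijective :
    ∃ Ψ : (EffArithDivisor.isPerfFactorial L).Rlf →* Multiplicative (Val L →₀ ℝ≥0),
      Function.Bijective Ψ ∧ ∀ a : EffArithDivisor L,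
        Ψ ((EffArithDivisor.isPerfFactorial L).toRealification (Perfection.of _ (Multiplicative.ofAdd a))) =
          Multiplicative.ofAdd (EffArithDivisor.realifyMod L a) := by
  have hP := EffArithDivisor.isPerfFactorial L
  -- the places ↔ the primes of `Φ(L)^pf`
  let P : Val L → Literature.AlgebraicGeometry.Frobenioids.Primes (Perfection (Multiplicative (EffArithDivisor L))) :=
    fun v => Quotient.mk (primarySetoid _) ⟨_, EffArithDivisor.isPrimary_of_single L v⟩
  have hPv : ∀ v, P v = Quotient.mk (primarySetoid _) ⟨_, EffArithDivisor.isPrimary_of_single L v⟩ := fun _ => rfl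
  have hPbij : Bijective P := EffArithDivisor.pfPrimeOf_bijective L
  -- coordinates `Φ(L)^rlf_𝔮 ≅ ℝ_{≥0}`
  have hj : ∀ 𝔮 : Literature.AlgebraicGeometry.Frobenioids.Primes (Perfection (Multiplicative (EffArithDivisor L))),
      Nonempty (RlfAt (Multiplicative (EffArithDivisor L)) 𝔮 ≃* Multiplicative ℝ≥0) :=
    fun 𝔮 => (hP.isRMonoprime_rlfAt 𝔮).nonempty_mulEquiv
  let j : ∀ 𝔮 : Literature.AlgebraicGeometry.Frobenioids.Primes (Perfection (Multiplicative (EffArithDivisor L))),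
      RlfAt (Multiplicative (EffArithDivisor L)) 𝔮 ≃* Multiplicative ℝ≥0 := fun 𝔮 => Classical.choice (hj 𝔮)
  -- `ι : Φ(L) → Φ(L)^rlf`
  let ι : Multiplicative (EffArithDivisor L) →* hP.Rlf := hP.toRealification.comp (Perfection.of _)
  have hι : ∀ a, ι a = hP.toRealification (Perfection.of _ a) := fun _ => rfl
  -- the raw `v`-degree `a ↦ (j (ι a)_{𝔮_v})`
  let D : Val L → (EffArithDivisor L →+ ℝ≥0) := fun v =>
    { toFun := fun a => Multiplicative.toAdd (j (P v)
        ((ι (Multiplicative.ofAdd a) : RlfFactor (Multiplicative (EffArithDivisor L))) (P v)))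
      map_zero' := by
        rw [ofAdd_zero, map_one, IsPerfFactorial.Rlf.coe_one, Pi.one_apply, map_one, toAdd_one]
      map_add' := fun a b => by
        rw [ofAdd_add, map_mul, IsPerfFactorial.Rlf.coe_mul, Pi.mul_apply, map_mul, toAdd_mul] }
  have hD : ∀ v a, D v a = Multiplicative.toAdd (j (P v)
      ((ι (Multiplicative.ofAdd a) : RlfFactor (Multiplicative (EffArithDivisor L))) (P v))) := fun _ _ => rfl
  have hD0 : ∀ v w : Val L, w ≠ v → D v (EffArithDivisor.single L w) = 0 := by
    intro v w hw
    have h1 : (ι (Multiplicative.ofAdd (EffArithDivisor.single L w)) :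
        RlfFactor (Multiplicative (EffArithDivisor L))) (P v) = 1 := EffArithDivisor.iota_single_apply_eq_one L hw
    rw [hD, h1, map_one, toAdd_one]
  have hDne : ∀ v : Val L, D v (EffArithDivisor.single L v) ≠ 0 := by
    intro v h0
    have h1 : (ι (Multiplicative.ofAdd (EffArithDivisor.single L v)) :
        RlfFactor (Multiplicative (EffArithDivisor L))) (P v) ≠ 1 := EffArithDivisor.iota_single_apply_ne_one L v
    rw [hD] at h0
    exact h1 (((j (P v)).map_eq_one_iff).mp (toAdd_eq_zero.mp h0))
  -- the normalising constants `c_v` with `c_v · D_v = realifyMod(·)_v`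
  let c : Val L → ℝ≥0 := fun v =>
    EffArithDivisor.realifyMod L (EffArithDivisor.single L v) v / D v (EffArithDivisor.single L v)
  have hcv : ∀ v, c v = EffArithDivisor.realifyMod L (EffArithDivisor.single L v) v / D v (EffArithDivisor.single L v) :=
    fun _ => rfl
  have hc : ∀ v, c v ≠ 0 := fun v => div_ne_zero (realifyMod_single_apply_self_ne_zero L v) (hDne v)
  have hcD : ∀ v a, c v * D v a = EffArithDivisor.realifyMod L a v := by
    intro v a
    have h1 : c v * (D v (EffArithDivisor.single L v) / EffArithDivisor.realifyMod L (EffArithDivisor.single L v) v) = 1 := by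
      rw [hcv, div_mul_div_comm, div_eq_one_iff_eq (mul_ne_zero (hDne v) (realifyMod_single_apply_self_ne_zero L v)),
        mul_comm]
    rw [degree_eq_mul_realifyMod_apply L v (hD0 v) a, ← mul_assoc, h1, one_mul]
  -- the map `Ψ`
  let raw : hP.Rlf → Val L → ℝ≥0 := fun x v =>
    c v * Multiplicative.toAdd (j (P v) ((x : RlfFactor (Multiplicative (EffArithDivisor L))) (P v)))
  have hraw : ∀ x v, raw x v =
      c v * Multiplicative.toAdd (j (P v) ((x : RlfFactor (Multiplicative (EffArithDivisor L))) (P v))) :=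
    fun _ _ => rfl
  have hraw_supp : ∀ x, (Function.support (raw x)).Finite := by
    intro x
    refine ((EffArithDivisor.supp_coe_rlf_finite L x).preimage hPbij.1.injOn).subset fun v hv => ?_
    rw [Set.mem_preimage]
    intro h1
    apply hv
    rw [hraw, h1, map_one, toAdd_one, mul_zero]
  let Ψf : hP.Rlf → (Val L →₀ ℝ≥0) := fun x => Finsupp.ofSupportFinite (raw x) (hraw_supp x)
  have hΨf : ∀ x v, Ψf x v =
      c v * Multiplicative.toAdd (j (P v) ((x : RlfFactor (Multiplicative (EffArithDivisor L))) (P v))) :=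
    fun _ _ => rfl
  let Ψ : hP.Rlf →* Multiplicative (Val L →₀ ℝ≥0) :=
    { toFun := fun x => Multiplicative.ofAdd (Ψf x)
      map_one' := by
        rw [ofAdd_eq_one]
        ext v
        rw [hΨf, IsPerfFactorial.Rlf.coe_one, Pi.one_apply, map_one, toAdd_one, mul_zero, Finsupp.zero_apply]
      map_mul' := fun x y => by
        rw [← ofAdd_add]
        congr 1
        ext v
        rw [Finsupp.add_apply, hΨf, hΨf, hΨf, IsPerfFactorial.Rlf.coe_mul, Pi.mul_apply, map_mul, toAdd_mul,
          mul_add] }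
  have hΨ : ∀ x, Ψ x = Multiplicative.ofAdd (Ψf x) := fun _ => rfl
  -- `Ψ` on one-prime elements
  have hΨsingle : ∀ (v : Val L) (y : RlfAt (Multiplicative (EffArithDivisor L)) (P v)),
      Ψ (hP.single (P v) y) = Multiplicative.ofAdd (Finsupp.single v (c v * Multiplicative.toAdd (j (P v) y))) := by
    intro v y
    rw [hΨ]
    congr 1
    ext w
    rw [hΨf, IsPerfFactorial.coe_single, Finsupp.single_apply]
    by_cases hvw : v = w
    · subst hvw
      rw [if_pos rfl, IsPerfFactorial.single'_apply_same]
    · rw [if_neg hvw, IsPerfFactorial.single'_apply_of_ne (fun h => hvw (hPbij.1 h).symm), map_one, toAdd_one,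
        mul_zero]
  refine ⟨Ψ, ⟨fun x y hxy => ?_, fun t => ?_⟩, fun a => ?_⟩
  · -- injective: all prime components agree
    rw [hΨ, hΨ] at hxy
    have hxy' := Multiplicative.ofAdd.injective hxy
    apply Subtype.ext
    funext 𝔮
    obtain ⟨v, rfl⟩ := hPbij.2 𝔮
    have hv := DFunLike.congr_fun hxy' v
    rw [hΨf, hΨf] at hv
    exact (j (P v)).injective (Multiplicative.toAdd.injective (mul_left_cancel₀ (hc v) hv))
  · -- surjective: a finite product of one-prime elements
    refine ⟨∏ v ∈ (Multiplicative.toAdd t).support,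
      hP.single (P v) ((j (P v)).symm (Multiplicative.ofAdd (Multiplicative.toAdd t v / c v))), ?_⟩
    rw [map_prod, Finset.prod_congr rfl fun v _ => hΨsingle v _, ← ofAdd_sum]
    conv_rhs => rw [← ofAdd_toAdd t, ← Finsupp.sum_single (Multiplicative.toAdd t), Finsupp.sum]
    congr 1
    refine Finset.sum_congr rfl fun v _ => ?_
    rw [MulEquiv.apply_symm_apply, toAdd_ofAdd, mul_div_cancel₀ _ (hc v)]
  · -- compatibility with `realifyMod`
    rw [hΨ]
    congr 1
    ext v
    rw [hΨf, ← hcD v a, hD]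
    rfl

/-- **THE isomorphism `Φ(L)^rlf ≃* Φ_{𝒞⊩_mod}` under `Φ(L)`** (`𝒞⊩_mod` = the realification of the Frobenioid of
arithmetic line bundles `†ℱ^⊛_mod` — our paraphrase, reading jointly [IUTchI] Ex 3.5 (i) p. 84 "the realification …
of the Frobenioid of [FrdI], Example 6.3 [cf. also Remark 3.1.5 …], associated to the number field `F_mod`",
Rmk 3.1.5 pp. 65–66, and Ex 5.1 (iii) p. 126 "the Frobenioid `†ℱ^⊛_mod` may be thought of as the Frobenioid of
arithmetic line bundles on the stack `S_mod` of Remark 3.1.5"): abc-iut-L5-t2's `Φ_{𝒞⊩_mod} = (V(L) →₀ ℝ_{≥0})` and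
abc-iut-L1's intrinsic `Φ(L)^rlf` ([FrdI] Def 2.4 (i)) are isomorphic by a (unique, `EffArithDivisor.rlf_hom_phiMod_ext`)
monoid isomorphism carrying `ι(a)` to `realifyMod(a)`. ([IUTchI] Ex 3.5 (i) p.84) [claim: Mochizuki2012, status: disputed] -/
theorem EffArithDivisor.exists_rlfEquiv_realifyMod :
    ∃ Ψ : (EffArithDivisor.isPerfFactorial L).Rlf ≃* Multiplicative (Val L →₀ ℝ≥0),
      ∀ a : EffArithDivisor L,
        Ψ ((EffArithDivisor.isPerfFactorial L).toRealification (Perfection.of _ (Multiplicative.ofAdd a))) =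
          Multiplicative.ofAdd (EffArithDivisor.realifyMod L a) := by
  obtain ⟨Ψ, hbij, hΨ⟩ := EffArithDivisor.exists_rlfHom_realifyMod_bijective L
  exact ⟨MulEquiv.ofBijective Ψ hbij, hΨ⟩

/-- **Uniqueness**: there is EXACTLY ONE homomorphism `Φ(L)^rlf → Φ_{𝒞⊩_mod}` extending `realifyMod` along `ι`
(and it is the isomorphism of `EffArithDivisor.exists_rlfEquiv_realifyMod`). ([IUTchI] Ex 3.5 (i) p.84)
[claim: Mochizuki2012, status: disputed] -/
theorem EffArithDivisor.existsUnique_rlfHom_realifyMod :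
    ∃! Ψ : (EffArithDivisor.isPerfFactorial L).Rlf →* Multiplicative (Val L →₀ ℝ≥0),
      ∀ a : EffArithDivisor L,
        Ψ ((EffArithDivisor.isPerfFactorial L).toRealification (Perfection.of _ (Multiplicative.ofAdd a))) =
          Multiplicative.ofAdd (EffArithDivisor.realifyMod L a) := by
  obtain ⟨Ψ, -, hΨ⟩ := EffArithDivisor.exists_rlfHom_realifyMod_bijective L
  exact ⟨Ψ, hΨ, fun Ψ' hΨ' => EffArithDivisor.rlf_hom_phiMod_ext L fun a => by rw [hΨ', hΨ]⟩

/-- The inverse direction, as used by consumers holding an element of `Φ_{𝒞⊩_mod}`: every finitely supported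
`ℝ_{≥0}`-valued function on `V(L)` is `Ψ` of a unique realified divisor, and `realifyMod(a)` comes from `ι(a)`.
([IUTchI] Ex 3.5 (i) p.84) [claim: Mochizuki2012, status: disputed] -/
theorem EffArithDivisor.exists_rlfEquiv_symm_realifyMod :
    ∃ Θ : Multiplicative (Val L →₀ ℝ≥0) ≃* (EffArithDivisor.isPerfFactorial L).Rlf,
      ∀ a : EffArithDivisor L,
        Θ (Multiplicative.ofAdd (EffArithDivisor.realifyMod L a)) =
          (EffArithDivisor.isPerfFactorial L).toRealification (Perfection.of _ (Multiplicative.ofAdd a)) := by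
  obtain ⟨Ψ, hΨ⟩ := EffArithDivisor.exists_rlfEquiv_realifyMod L
  exact ⟨Ψ.symm, fun a => by rw [← hΨ a, MulEquiv.symm_apply_apply]⟩

end Literature.IUT.HodgeTheaters

end
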